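import Mathlib.MeasureTheory.Integral.Layercake
import Mathlib.MeasureTheory.Measure.Lebesgue.Basic
import Mathlib.MeasureTheory.Measure.Real
import Mathlib.Probability.Kernel.Composition.MeasureCompProd
import Mathlib.Probability.Kernel.Composition.IntegralCompProd
import Mathlib.Probability.Kernel.Invariance
import HarnessLib

/-!
# Cheeger's inequality for Markov chains on a GENERAL state space (Lawler–Sokal 1988, Thm 2.1,
# lower bound, discrete time): conductance `k` ⇒ `(k²/8)·Var_π(f) ≤ 𝓔(f)`

G. F. Lawler, A. D. Sokal, *Bounds on the `L²` spectrum for Markov chains and Markov processes: a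
generalization of Cheeger's inequality*, Trans. Amer. Math. Soc. **309** (1988) 557–580, §2
(pp. 558–561 of the held copy [LawlerSokal1988]). The tree already has the FINITE-state-space
version (Levin–Peres–Wilmer, Thm 13.10: `Literature.Probability.MarkovChains.CheegerInequality`,
`Φ⋆²/2 ≤ Gap_R`, with `Fintype X`); this file proves the general measurable-state-space version,
which is the one needed for transfer / slice chains of lattice field theories (continuous
single-site spaces).

## Setting (Lawler–Sokal (2.1)–(2.3), (2.13)–(2.15) with `M = 1`)

`(X, 𝒳)` a measurable space, `π` a probability measure on `X`, and `ρ` a finite measure on `X × X`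
whose two marginals are BOTH `π` ("`ρ(dx,dy) = π(dx)P(x,dy)` is a positive measure on `S × S`
whose marginals are equal", (2.14) with `M = 1`; for a Markov kernel `P` with invariant probability
`π` this is `ρ = π ⊗ P`, see `cheeger_variance_le_dirichletForm_kernel`). We do NOT assume that `ρ`
is symmetric (reversibility): as in Levin–Peres–Wilmer's proof, only `ρ(A × Aᶜ) = ρ(Aᶜ × A)`
(equal marginals) is used for the Dirichlet-form inequality.

* `couplingDirichletForm ρ f = 𝓔_ρ(f) = ½ ∫ (f x − f y)² dρ(x,y)` — the form (2.15);
* the conductance hypothesis `HasCouplingConductance π ρ k` is taken SETWISE,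
  `k·π(A)·π(Aᶜ) ≤ ρ(A × Aᶜ)` for every measurable `A` (i.e. `k ≤ k(A)` for all `A` with
  `0 < π(A) < 1`, (2.2)–(2.3); sets with `π(A) ∈ {0,1}` satisfy it trivially), which avoids an
  `inf` over an arbitrary σ-algebra.

## Results (all PROVED; no named fact, no sorry)

* `coarea_lintegral_le` / `coarea_integral_le` — the co-area (layer-cake) inequality, the
  general-state-space form of Levin–Peres–Wilmer Lemma 13.13: for bounded measurable `ψ ≥ 0` with
  `π{ψ > 0} ≤ ½`, `k·∫ψ dπ ≤ ∫ |ψ x − ψ y| dρ`.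
* `cheeger_sq_integral_le_dirichletForm` — for bounded measurable `f ≥ 0` with `π{f > 0} ≤ ½`:
  `(k²/8)·∫ f² dπ ≤ 𝓔_ρ(f)`.
* **`cheeger_variance_le_dirichletForm`** (Lawler–Sokal Thm 2.1, lower bound, `M = 1`, their
  constant `κ ≥ 1` replaced by `1`; = Levin–Peres–Wilmer Thm 13.10 lower bound on a general state
  space): for bounded measurable `f`, **`(k²/8)·∫ (f − ∫f dπ)² dπ ≤ 𝓔_ρ(f)`**.
* `cheeger_variance_le_dirichletForm_kernel`, `dirichletForm_kernel_eq_sq_sub_inner`,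
  `cheeger_inner_kernel_le` — the same for a Markov kernel `κ` with invariant probability `π`
  (`ρ = π ⊗ₘ κ`): `(k²/8)·Var_π(f) ≤ ½∫∫(f x − f y)² κ(x,dy)π(dx) = ∫f² dπ − ∫ f·(κf) dπ` and, for
  `∫ f dπ = 0`, `∫ f·(κf) dπ ≤ (1 − k²/8)·∫ f² dπ` — the bound `λ₁(I − P) ≥ k²/8` of (2.17) on the
  quadratic form of `P` restricted to `1^⊥` (for a reversible NONNEGATIVE `P`, e.g. the
  ground-state transform of a reflection-positive transfer operator, this is the spectral gap).
* `couplingDirichletForm_indicator`, `integral_sq_indicator_sub_mean`,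
  `couplingDirichletForm_indicator_eq_conductance_mul`, `poincareConstant_le_conductance` — the
  trivial direction of Thm 2.1 ((2.18): the Rayleigh quotient of the trial function `1_A` is
  `k(A) = ρ(A × Aᶜ)/(π(A)π(Aᶜ))`, so the best variance constant is `≤ k(A)` for every `A`).

## Proof (Cheeger / Lawler–Sokal / LPW §13.2.3, written measure-theoretically)

(1) `(ψ x − ψ y)⁺ = Leb(Ico (ψ y) (ψ x))`, so by Tonelli `∫ (ψ x − ψ y)⁺ dρ = ∫₀^∞ ρ(S_t × S_tᶜ) dt`
with `S_t = {ψ > t}`; the conductance hypothesis and `π(S_tᶜ) ≥ ½` (`t ≥ 0`) give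
`ρ(S_t × S_tᶜ) ≥ (k/2)π(S_t)`, and `∫₀^∞ π(S_t) dt = ∫ψ dπ` (layer cake). The mirrored orientation
follows by applying this to `ρ ∘ swap⁻¹`, whose marginals are again `π` and which satisfies the same
hypothesis because `ρ(Aᶜ × A) = ρ(A × Aᶜ)`. (2) With `ψ = f²`,
`|f²x − f²y| = |fx − fy|(fx + fy) ≤ (2/k)(fx − fy)² + (k/8)(fx + fy)²` (AM–GM at the parameter
`t = 4/k`) and `∫(fx + fy)² dρ ≤ 4∫f² dπ` give `(k²/8)∫f² ≤ 𝓔(f)` — this replaces the Cauchy–Schwarz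
display of the printed proof and yields the same constant. (3) A median `c` of `f` splits
`f − c = f₊ − f₋` with `π{f₊ > 0}, π{f₋ > 0} ≤ ½`, `𝓔(f₊) + 𝓔(f₋) ≤ 𝓔(f)` and
`Var_π(f) ≤ ∫(f − c)² = ∫f₊² + ∫f₋²`.

Written for cell ym-ir (seat ym-ir-lit-4) as the literature input of the seam `stub_cheeger` of the
line `Cruxes/IR/Lines/vacuum_escape.lean` (slice chain of the Wilson transfer operator on
`GaugeConfig 3 N G`, a continuous state space). HONEST FRAMING: a Markov-chain inequality; nothing
here bears on the Yang–Mills mass gap.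
-/

noncomputable section

open MeasureTheory Set
open scoped ENNReal ProbabilityTheory

namespace Literature.Probability.MarkovChains

variable {X : Type*} [MeasurableSpace X]

/-! ### Definitions -/

/-- The **Dirichlet form of a coupling** `ρ` on `X × X`:
`𝓔_ρ(f) = ½ ∫ (f x − f y)² dρ(x,y)` (Lawler–Sokal (2.15) with `ρ(dx,dy) = π(dx)P(x,dy)`, `M = 1`;
for a Markov kernel this is `∫ f² dπ − ⟨f, Pf⟩_{L²(π)}`, see `dirichletForm_kernel_eq_sq_sub_inner`).
[cite: LawlerSokal1988, §2 (2.13)–(2.15)] -/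
def couplingDirichletForm (ρ : Measure (X × X)) (f : X → ℝ) : ℝ :=
  (1 / 2) * ∫ p, (f p.1 - f p.2) ^ 2 ∂ρ

/-- The **setwise conductance hypothesis** `k ≤ k(A)` for every measurable `A`:
`k · π(A) · π(Aᶜ) ≤ ρ(A × Aᶜ)` (Lawler–Sokal (2.2)–(2.3): `k(A) = ρ(A × Aᶜ)/(π(A)π(Aᶜ))`,
`k = inf_{0 < π(A) < 1} k(A)`; sets with `π(A)π(Aᶜ) = 0` satisfy the inequality trivially).
[cite: LawlerSokal1988, §2 (2.2)–(2.3)] -/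
def HasCouplingConductance (π : Measure X) (ρ : Measure (X × X)) (k : ℝ) : Prop :=
  ∀ A : Set X, MeasurableSet A → k * π.real A * π.real Aᶜ ≤ ρ.real (A ×ˢ Aᶜ)

/-! ### Equal marginals: `ρ(Aᶜ × A) = ρ(A × Aᶜ)` and invariance under `swap` -/

section Marginals

variable {π : Measure X} {ρ : Measure (X × X)}

/-- `ρ(A × univ) = π(A)` when the first marginal of `ρ` is `π`. [folklore] -/
private theorem measure_prod_univ_eq (hfst : ρ.fst = π) {A : Set X} (hA : MeasurableSet A) :
    ρ (A ×ˢ (univ : Set X)) = π A := by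
  rw [← hfst, Measure.fst_apply hA, prod_univ]

/-- `ρ(univ × A) = π(A)` when the second marginal of `ρ` is `π`. [folklore] -/
private theorem measure_univ_prod_eq (hsnd : ρ.snd = π) {A : Set X} (hA : MeasurableSet A) :
    ρ ((univ : Set X) ×ˢ A) = π A := by
  rw [← hsnd, Measure.snd_apply hA, univ_prod]

/-- **Equal marginals ⇒ equal boundary flows**: `ρ(Aᶜ × A) = ρ(A × Aᶜ)` — Levin–Peres–Wilmer,
*Markov Chains and Mixing Times* (2nd ed.), Exercise 7.2: `Q(S,Sᶜ) = Q(Sᶜ,S)` "holds generally" for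
a stationary chain (needs equal marginals only, not reversibility); here for couplings on a general
state space. [cite: LevinPeres2017, Exercise 7.2] -/
theorem measure_compl_prod_eq_prod_compl [IsFiniteMeasure ρ] (hfst : ρ.fst = π) (hsnd : ρ.snd = π)
    {A : Set X} (hA : MeasurableSet A) : ρ (Aᶜ ×ˢ A) = ρ (A ×ˢ Aᶜ) := by
  have h1 : ρ (A ×ˢ Aᶜ) + ρ (A ×ˢ A) = π A := by
    rw [← measure_prod_univ_eq hfst hA, ← compl_union_self A, prod_union]
    exact (measure_union (Set.disjoint_prod.2 (Or.inr disjoint_compl_left)) (hA.prod hA)).symm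
  have h2 : ρ (Aᶜ ×ˢ A) + ρ (A ×ˢ A) = π A := by
    rw [← measure_univ_prod_eq hsnd hA, ← compl_union_self A, union_prod]
    exact (measure_union (Set.disjoint_prod.2 (Or.inl disjoint_compl_left)) (hA.prod hA)).symm
  have hfin : ρ (A ×ˢ A) ≠ ∞ := measure_ne_top ρ _
  exact (ENNReal.add_left_inj hfin).1 (h2.trans h1.symm)

/-- The swapped coupling `ρ ∘ swap⁻¹` has first marginal `π`. [folklore] -/
private theorem fst_map_swap_eq (hsnd : ρ.snd = π) : (ρ.map Prod.swap).fst = π := by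
  rw [Measure.fst_map_swap, hsnd]

/-- The swapped coupling `ρ ∘ swap⁻¹` has second marginal `π`. [folklore] -/
private theorem snd_map_swap_eq (hfst : ρ.fst = π) : (ρ.map Prod.swap).snd = π := by
  rw [Measure.snd_map_swap, hfst]

/-- The conductance hypothesis is invariant under swapping the coupling: by
`Q(S,Sᶜ) = Q(Sᶜ,S)` (Levin–Peres–Wilmer Exercise 7.2) the flow `ρ(A × Aᶜ)` is the same for `ρ`
and `ρ ∘ swap⁻¹`. [cite: LevinPeres2017, Exercise 7.2] -/
theorem HasCouplingConductance.map_swap [IsFiniteMeasure ρ] {k : ℝ}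
    (hk : HasCouplingConductance π ρ k) (hfst : ρ.fst = π) (hsnd : ρ.snd = π) :
    HasCouplingConductance π (ρ.map Prod.swap) k := by
  intro A hA
  have h := hk A hA
  rw [measureReal_def (ρ.map Prod.swap), Measure.map_apply measurable_swap (hA.prod hA.compl),
    preimage_swap_prod, measure_compl_prod_eq_prod_compl hfst hsnd hA, ← measureReal_def]
  exact h

end Marginals

/-! ### Step 1: the co-area (layer-cake) inequality (LPW Lemma 13.13 on a general state space) -/

section Coarea

variable {π : Measure X} [IsProbabilityMeasure π] {ρ : Measure (X × X)} [IsFiniteMeasure ρ]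

/-- `ENNReal.ofReal (max u 0) = ENNReal.ofReal u`. [folklore] -/
private theorem ofReal_max_zero (u : ℝ) : ENNReal.ofReal (max u 0) = ENNReal.ofReal u := by
  rcases le_total u 0 with h | h
  · rw [max_eq_right h, ENNReal.ofReal_zero, ENNReal.ofReal_of_nonpos h]
  · rw [max_eq_left h]

/-- Integrability of a bounded measurable real function against a finite measure (helper).
[folklore] -/
private theorem integrable_of_abs_le {Y : Type*} [MeasurableSpace Y] {μ : Measure Y} [IsFiniteMeasure μ]
    {g : Y → ℝ} (hg : Measurable g) {C : ℝ} (hC : ∀ y, |g y| ≤ C) : Integrable g μ :=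
  Integrable.mono' (integrable_const C) hg.aestronglyMeasurable
    (Filter.Eventually.of_forall fun y => by simpa [Real.norm_eq_abs] using hC y)

/-- For `t ≥ 0` (so that `{ψ > t} ⊆ {ψ > 0}`) the conductance hypothesis and `π{ψ > 0} ≤ ½` give
`(k/2)·π{ψ > t} ≤ ρ({ψ > t} × {ψ > t}ᶜ)`. [cite: LawlerSokal1988, §2 proof of Thm 2.1 (lower bound)] -/
theorem half_mul_measure_le_flow {k : ℝ} (hk : 0 ≤ k) (hcond : HasCouplingConductance π ρ k)
    {ψ : X → ℝ} (hψm : Measurable ψ) (hhalf : π.real {x | 0 < ψ x} ≤ 1 / 2) {t : ℝ} (ht : 0 ≤ t) :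
    ENNReal.ofReal (k / 2) * π {x | t < ψ x} ≤ ρ ({x | t < ψ x} ×ˢ {x | t < ψ x}ᶜ) := by
  have hS : MeasurableSet {x | t < ψ x} := measurableSet_lt measurable_const hψm
  -- `π(S_tᶜ) ≥ 1/2`
  have hsub : {x | t < ψ x} ⊆ {x | 0 < ψ x} := fun x hx => lt_of_le_of_lt ht hx
  have hScompl : 1 / 2 ≤ π.real {x | t < ψ x}ᶜ := by
    rw [probReal_compl_eq_one_sub hS]
    have : π.real {x | t < ψ x} ≤ 1 / 2 := (measureReal_mono hsub).trans hhalf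
    linarith
  have h := hcond _ hS
  -- real form: (k/2) π(S) ≤ k π(S) π(Sᶜ) ≤ ρ(S × Sᶜ)
  have hreal : k / 2 * π.real {x | t < ψ x} ≤ ρ.real ({x | t < ψ x} ×ˢ {x | t < ψ x}ᶜ) := by
    have h0 : 0 ≤ π.real {x | t < ψ x} := measureReal_nonneg
    calc k / 2 * π.real {x | t < ψ x} = k * π.real {x | t < ψ x} * (1 / 2) := by ring
      _ ≤ k * π.real {x | t < ψ x} * π.real {x | t < ψ x}ᶜ :=
          mul_le_mul_of_nonneg_left hScompl (mul_nonneg hk h0)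
      _ ≤ _ := h
  -- back to `ℝ≥0∞`
  have hfinπ : π {x | t < ψ x} ≠ ∞ := measure_ne_top π _
  have hfinρ : ρ ({x | t < ψ x} ×ˢ {x | t < ψ x}ᶜ) ≠ ∞ := measure_ne_top ρ _
  calc ENNReal.ofReal (k / 2) * π {x | t < ψ x}
      = ENNReal.ofReal (k / 2 * π.real {x | t < ψ x}) := by
        rw [measureReal_def, ENNReal.ofReal_mul (by linarith), ENNReal.ofReal_toReal hfinπ]
    _ ≤ ENNReal.ofReal (ρ.real ({x | t < ψ x} ×ˢ {x | t < ψ x}ᶜ)) := ENNReal.ofReal_le_ofReal hreal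
    _ = ρ ({x | t < ψ x} ×ˢ {x | t < ψ x}ᶜ) := by rw [measureReal_def, ENNReal.ofReal_toReal hfinρ]

/-- **Co-area inequality, one orientation** (`ℝ≥0∞` form): for measurable `ψ ≥ 0` with
`π{ψ > 0} ≤ ½`, `(k/2)·∫ψ dπ ≤ ∫ (ψ x − ψ y)⁺ dρ(x,y)`. Proof: `(ψx − ψy)⁺ = Leb[ψy, ψx)`, Tonelli,
`{(x,y) : ψ y ≤ t < ψ x} = S_t × S_tᶜ`, `half_mul_measure_le_flow`, and the layer-cake formula
`∫₀^∞ π(S_t) dt = ∫ψ dπ`. [cite: LawlerSokal1988, §2 proof of Thm 2.1 (lower bound)] -/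
theorem coarea_lintegral_le {k : ℝ} (hk : 0 ≤ k) (hcond : HasCouplingConductance π ρ k)
    {ψ : X → ℝ} (hψm : Measurable ψ) (hψ0 : ∀ x, 0 ≤ ψ x) (hhalf : π.real {x | 0 < ψ x} ≤ 1 / 2) :
    ENNReal.ofReal (k / 2) * ∫⁻ x, ENNReal.ofReal (ψ x) ∂π ≤
      ∫⁻ p, ENNReal.ofReal (ψ p.1 - ψ p.2) ∂ρ := by
  -- the measurable "graph slab" `E = {(p,t) : ψ p.2 ≤ t < ψ p.1}`
  set E : Set ((X × X) × ℝ) := {q | ψ q.1.2 ≤ q.2 ∧ q.2 < ψ q.1.1} with hE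
  have hEm : MeasurableSet E := by
    refine MeasurableSet.inter ?_ ?_
    · exact measurableSet_le (hψm.comp (measurable_snd.comp measurable_fst)) measurable_snd
    · exact measurableSet_lt measurable_snd (hψm.comp (measurable_fst.comp measurable_fst))
  -- (ψ x − ψ y)⁺ as a Lebesgue measure, then as an inner integral of the indicator of `E`
  have hpt : ∀ p : X × X, ENNReal.ofReal (ψ p.1 - ψ p.2) =
      ∫⁻ t, E.indicator (fun _ => (1 : ℝ≥0∞)) (p, t) ∂volume := by
    intro p
    have hset : (fun t => E.indicator (fun _ => (1 : ℝ≥0∞)) (p, t)) =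
        (Ico (ψ p.2) (ψ p.1)).indicator 1 := by
      funext t
      by_cases h : ψ p.2 ≤ t ∧ t < ψ p.1
      · rw [Set.indicator_of_mem (show (p, t) ∈ E from h), Set.indicator_of_mem (mem_Ico.2 h)]
        rfl
      · rw [Set.indicator_of_notMem (show (p, t) ∉ E from h),
          Set.indicator_of_notMem (fun h' => h (mem_Ico.1 h'))]
    rw [hset, lintegral_indicator_one measurableSet_Ico, Real.volume_Ico]
  have hF : Measurable (fun q : (X × X) × ℝ => E.indicator (fun _ => (1 : ℝ≥0∞)) q) :=
    measurable_const.indicator hEm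
  calc ENNReal.ofReal (k / 2) * ∫⁻ x, ENNReal.ofReal (ψ x) ∂π
      = ENNReal.ofReal (k / 2) * ∫⁻ t in Ioi 0, π {x | t < ψ x} := by
        rw [lintegral_eq_lintegral_meas_lt π (Filter.Eventually.of_forall hψ0) hψm.aemeasurable]
    _ = ∫⁻ t in Ioi 0, ENNReal.ofReal (k / 2) * π {x | t < ψ x} :=
        (lintegral_const_mul' _ _ ENNReal.ofReal_ne_top).symm
    _ ≤ ∫⁻ t in Ioi 0, ρ ({x | t < ψ x} ×ˢ {x | t < ψ x}ᶜ) :=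
        setLIntegral_mono' measurableSet_Ioi fun t ht =>
          half_mul_measure_le_flow hk hcond hψm hhalf (le_of_lt ht)
    _ = ∫⁻ t in Ioi 0, ∫⁻ p, E.indicator (fun _ => (1 : ℝ≥0∞)) (p, t) ∂ρ := by
        refine setLIntegral_congr_fun measurableSet_Ioi fun t _ => ?_
        have hS : MeasurableSet {x | t < ψ x} := measurableSet_lt measurable_const hψm
        have hset : (fun p : X × X => E.indicator (fun _ => (1 : ℝ≥0∞)) (p, t)) =
            ({x | t < ψ x} ×ˢ {x | t < ψ x}ᶜ).indicator 1 := by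
          funext p
          by_cases h : ψ p.2 ≤ t ∧ t < ψ p.1
          · have hp : p ∈ {x | t < ψ x} ×ˢ {x | t < ψ x}ᶜ :=
              ⟨h.2, fun h' => absurd (lt_of_lt_of_le h' h.1) (lt_irrefl _)⟩
            rw [Set.indicator_of_mem (show (p, t) ∈ E from h), Set.indicator_of_mem hp]
            rfl
          · have hp : p ∉ {x | t < ψ x} ×ˢ {x | t < ψ x}ᶜ := by
              rintro ⟨h1, h2⟩
              exact h ⟨le_of_not_gt h2, h1⟩
            rw [Set.indicator_of_notMem (show (p, t) ∉ E from h), Set.indicator_of_notMem hp]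
        show ρ ({x | t < ψ x} ×ˢ {x | t < ψ x}ᶜ) =
          ∫⁻ p, (fun p : X × X => E.indicator (fun _ => (1 : ℝ≥0∞)) (p, t)) p ∂ρ
        rw [hset, lintegral_indicator_one (hS.prod hS.compl)]
    _ ≤ ∫⁻ t, ∫⁻ p, E.indicator (fun _ => (1 : ℝ≥0∞)) (p, t) ∂ρ ∂volume :=
        setLIntegral_le_lintegral _ _
    _ = ∫⁻ p, ∫⁻ t, E.indicator (fun _ => (1 : ℝ≥0∞)) (p, t) ∂volume ∂ρ :=
        lintegral_lintegral_swap (hF.comp measurable_swap).aemeasurable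
    _ = ∫⁻ p, ENNReal.ofReal (ψ p.1 - ψ p.2) ∂ρ := lintegral_congr fun p => (hpt p).symm

/-- **Co-area inequality, two-sided real form** (general-state-space Lemma 13.13 of
Levin–Peres–Wilmer): for bounded measurable `ψ ≥ 0` with `π{ψ > 0} ≤ ½` and `k ≥ 0`,
`k · ∫ψ dπ ≤ ∫ |ψ x − ψ y| dρ(x,y)` — the sum of the two oriented inequalities, the second one being
the first for the swapped coupling. [cite: LawlerSokal1988, §2 proof of Thm 2.1 (lower bound)] -/
theorem coarea_integral_le (hfst : ρ.fst = π) (hsnd : ρ.snd = π) {k : ℝ} (hk : 0 ≤ k)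
    (hcond : HasCouplingConductance π ρ k) {ψ : X → ℝ} (hψm : Measurable ψ) (hψ0 : ∀ x, 0 ≤ ψ x)
    {C : ℝ} (hC : ∀ x, |ψ x| ≤ C) (hhalf : π.real {x | 0 < ψ x} ≤ 1 / 2) :
    k * ∫ x, ψ x ∂π ≤ ∫ p, |ψ p.1 - ψ p.2| ∂ρ := by
  haveI : IsFiniteMeasure (ρ.map Prod.swap) := by infer_instance
  -- integrability bookkeeping
  have hψi : Integrable ψ π := integrable_of_abs_le hψm hC
  have hm1 : Measurable fun p : X × X => ψ p.1 - ψ p.2 :=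
    (hψm.comp measurable_fst).sub (hψm.comp measurable_snd)
  have hm2 : Measurable fun p : X × X => ψ p.2 - ψ p.1 :=
    (hψm.comp measurable_snd).sub (hψm.comp measurable_fst)
  have hb1 : ∀ p : X × X, |max (ψ p.1 - ψ p.2) 0| ≤ 2 * C := by
    intro p
    rw [abs_of_nonneg (le_max_right _ _)]
    refine max_le ?_ (by linarith [abs_nonneg (ψ p.1), hC p.1])
    linarith [le_abs_self (ψ p.1), neg_abs_le (ψ p.2), hC p.1, hC p.2]
  have hb2 : ∀ p : X × X, |max (ψ p.2 - ψ p.1) 0| ≤ 2 * C := by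
    intro p
    rw [abs_of_nonneg (le_max_right _ _)]
    refine max_le ?_ (by linarith [abs_nonneg (ψ p.1), hC p.1])
    linarith [le_abs_self (ψ p.2), neg_abs_le (ψ p.1), hC p.1, hC p.2]
  have hi1 : Integrable (fun p : X × X => max (ψ p.1 - ψ p.2) 0) ρ :=
    integrable_of_abs_le (hm1.max measurable_const) hb1
  have hi2 : Integrable (fun p : X × X => max (ψ p.2 - ψ p.1) 0) ρ :=
    integrable_of_abs_le (hm2.max measurable_const) hb2
  have hψ0' : 0 ≤ᵐ[π] ψ := Filter.Eventually.of_forall hψ0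
  -- orientation 1
  have hA : k / 2 * ∫ x, ψ x ∂π ≤ ∫ p, max (ψ p.1 - ψ p.2) 0 ∂ρ := by
    have h := coarea_lintegral_le hk hcond hψm hψ0 hhalf
    rw [← ofReal_integral_eq_lintegral_ofReal hψi hψ0'] at h
    have h' : ∫⁻ p, ENNReal.ofReal (ψ p.1 - ψ p.2) ∂ρ =
        ENNReal.ofReal (∫ p, max (ψ p.1 - ψ p.2) 0 ∂ρ) := by
      rw [ofReal_integral_eq_lintegral_ofReal hi1
        (Filter.Eventually.of_forall fun p => le_max_right _ _)]
      exact lintegral_congr fun p => (ofReal_max_zero _).symm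
    rw [h', ← ENNReal.ofReal_mul (by linarith)] at h
    exact (ENNReal.ofReal_le_ofReal_iff (integral_nonneg fun p => le_max_right _ _)).1 h
  -- orientation 2, via the swapped coupling
  have hB : k / 2 * ∫ x, ψ x ∂π ≤ ∫ p, max (ψ p.2 - ψ p.1) 0 ∂ρ := by
    have hcond' := hcond.map_swap hfst hsnd
    have h := coarea_lintegral_le (ρ := ρ.map Prod.swap) hk hcond' hψm hψ0 hhalf
    rw [lintegral_map hm1.ennreal_ofReal measurable_swap,
      ← ofReal_integral_eq_lintegral_ofReal hψi hψ0'] at h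
    change ENNReal.ofReal (k / 2) * ENNReal.ofReal (∫ x, ψ x ∂π) ≤
      ∫⁻ p : X × X, ENNReal.ofReal (ψ p.2 - ψ p.1) ∂ρ at h
    have h' : ∫⁻ p : X × X, ENNReal.ofReal (ψ p.2 - ψ p.1) ∂ρ =
        ENNReal.ofReal (∫ p, max (ψ p.2 - ψ p.1) 0 ∂ρ) := by
      rw [ofReal_integral_eq_lintegral_ofReal hi2
        (Filter.Eventually.of_forall fun p => le_max_right _ _)]
      exact lintegral_congr fun p => (ofReal_max_zero _).symm
    rw [h', ← ENNReal.ofReal_mul (by linarith)] at h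
    exact (ENNReal.ofReal_le_ofReal_iff (integral_nonneg fun p => le_max_right _ _)).1 h
  -- add
  have hsum : ∫ p, max (ψ p.1 - ψ p.2) 0 ∂ρ + ∫ p, max (ψ p.2 - ψ p.1) 0 ∂ρ =
      ∫ p, |ψ p.1 - ψ p.2| ∂ρ := by
    rw [← integral_add hi1 hi2]
    refine integral_congr_ae (Filter.Eventually.of_forall fun p => ?_)
    have : ψ p.2 - ψ p.1 = -(ψ p.1 - ψ p.2) := by ring
    simp only [this, max_zero_add_max_neg_zero_eq_abs_self]
  linarith

end Coarea

/-! ### Step 2: squares — `(k²/8)·∫ f² dπ ≤ 𝓔(f)` for `f ≥ 0` supported on a set of mass `≤ ½` -/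

section Squares

variable {π : Measure X} [IsProbabilityMeasure π] {ρ : Measure (X × X)} [IsFiniteMeasure ρ]

omit [IsProbabilityMeasure π] [IsFiniteMeasure ρ] in
/-- First-marginal transport: `∫ g(x) dρ(x,y) = ∫ g dπ`. [folklore] -/
private theorem integral_comp_fst_eq (hfst : ρ.fst = π) {g : X → ℝ} (hg : Measurable g) :
    ∫ p, g p.1 ∂ρ = ∫ x, g x ∂π := by
  rw [← hfst, Measure.fst, integral_map measurable_fst.aemeasurable hg.aestronglyMeasurable]

omit [IsProbabilityMeasure π] [IsFiniteMeasure ρ] in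
/-- Second-marginal transport: `∫ g(y) dρ(x,y) = ∫ g dπ`. [folklore] -/
private theorem integral_comp_snd_eq (hsnd : ρ.snd = π) {g : X → ℝ} (hg : Measurable g) :
    ∫ p, g p.2 ∂ρ = ∫ x, g x ∂π := by
  rw [← hsnd, Measure.snd, integral_map measurable_snd.aemeasurable hg.aestronglyMeasurable]

omit [MeasurableSpace X] in
/-- AM–GM at the parameter `4/k`: for `k > 0` and reals `u`, `v`,
`|u|·v ≤ (2/k)·u² + (k/8)·v²`. [folklore] -/
private theorem abs_mul_le_amgm {k : ℝ} (hk : 0 < k) (u v : ℝ) :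
    |u| * v ≤ 2 / k * u ^ 2 + k / 8 * v ^ 2 := by
  have hk' : k ≠ 0 := hk.ne'
  have h : 0 ≤ (2 / k) * (2 * |u| - k / 2 * v) ^ 2 := by positivity
  have hexp : (2 / k) * (2 * |u| - k / 2 * v) ^ 2 =
      8 / k * |u| ^ 2 - 4 * (|u| * v) + k / 2 * v ^ 2 := by
    field_simp
    ring
  rw [hexp, sq_abs] at h
  have h8 : 8 / k * u ^ 2 = 4 * (2 / k * u ^ 2) := by ring
  rw [h8] at h
  linarith

/-- **Squares step** (the Cauchy–Schwarz display of the printed proof, here by AM–GM): for bounded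
measurable `f ≥ 0` with `π{f > 0} ≤ ½` and `k ≥ 0`, `(k²/8)·∫ f² dπ ≤ 𝓔_ρ(f)`.
[cite: LawlerSokal1988, §2 proof of Thm 2.1 (lower bound)] -/
theorem cheeger_sq_integral_le_dirichletForm (hfst : ρ.fst = π) (hsnd : ρ.snd = π) {k : ℝ}
    (hk : 0 ≤ k) (hcond : HasCouplingConductance π ρ k) {f : X → ℝ} (hfm : Measurable f)
    (hf0 : ∀ x, 0 ≤ f x) {C : ℝ} (hC : ∀ x, |f x| ≤ C) (hhalf : π.real {x | 0 < f x} ≤ 1 / 2) :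
    k ^ 2 / 8 * ∫ x, f x ^ 2 ∂π ≤ couplingDirichletForm ρ f := by
  -- basic integrability
  have hsqm : Measurable fun x => f x ^ 2 := hfm.pow_const 2
  have hsqb : ∀ x, |f x ^ 2| ≤ C ^ 2 := fun x => by
    rw [abs_pow]; exact pow_le_pow_left₀ (abs_nonneg _) (hC x) 2
  have hDm : Measurable fun p : X × X => (f p.1 - f p.2) ^ 2 :=
    ((hfm.comp measurable_fst).sub (hfm.comp measurable_snd)).pow_const 2
  have hSm : Measurable fun p : X × X => (f p.1 + f p.2) ^ 2 :=
    ((hfm.comp measurable_fst).add (hfm.comp measurable_snd)).pow_const 2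
  have hDb : ∀ p : X × X, |(f p.1 - f p.2) ^ 2| ≤ (2 * C) ^ 2 := by
    intro p
    rw [abs_pow]
    refine pow_le_pow_left₀ (abs_nonneg _) ?_ 2
    calc |f p.1 - f p.2| ≤ |f p.1| + |f p.2| := abs_sub _ _
      _ ≤ 2 * C := by linarith [hC p.1, hC p.2]
  have hSb : ∀ p : X × X, |(f p.1 + f p.2) ^ 2| ≤ (2 * C) ^ 2 := by
    intro p
    rw [abs_pow]
    refine pow_le_pow_left₀ (abs_nonneg _) ?_ 2
    calc |f p.1 + f p.2| ≤ |f p.1| + |f p.2| := abs_add_le _ _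
      _ ≤ 2 * C := by linarith [hC p.1, hC p.2]
  have hDi : Integrable (fun p : X × X => (f p.1 - f p.2) ^ 2) ρ := integrable_of_abs_le hDm hDb
  have hSi : Integrable (fun p : X × X => (f p.1 + f p.2) ^ 2) ρ := integrable_of_abs_le hSm hSb
  set a : ℝ := ∫ x, f x ^ 2 ∂π with ha
  set D : ℝ := ∫ p, (f p.1 - f p.2) ^ 2 ∂ρ with hD
  set S : ℝ := ∫ p, (f p.1 + f p.2) ^ 2 ∂ρ with hS
  have hED : couplingDirichletForm ρ f = 1 / 2 * D := rfl
  have hD0 : 0 ≤ D := integral_nonneg fun p => sq_nonneg _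
  have ha0 : 0 ≤ a := integral_nonneg fun x => sq_nonneg _
  -- `S ≤ 4a` from `(u+v)² ≤ 2u² + 2v²` and the marginals
  have hS4 : S ≤ 4 * a := by
    have h1 : ∫ p, f p.1 ^ 2 ∂ρ = a := integral_comp_fst_eq hfst hsqm
    have h2 : ∫ p, f p.2 ^ 2 ∂ρ = a := integral_comp_snd_eq hsnd hsqm
    have hi1 : Integrable (fun p : X × X => f p.1 ^ 2) ρ :=
      integrable_of_abs_le (hsqm.comp measurable_fst) fun p => hsqb p.1
    have hi2 : Integrable (fun p : X × X => f p.2 ^ 2) ρ :=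
      integrable_of_abs_le (hsqm.comp measurable_snd) fun p => hsqb p.2
    calc S ≤ ∫ p, (2 * f p.1 ^ 2 + 2 * f p.2 ^ 2) ∂ρ := by
          refine integral_mono hSi ((hi1.const_mul 2).add (hi2.const_mul 2)) fun p => ?_
          have := sq_nonneg (f p.1 - f p.2)
          simp only
          nlinarith
      _ = 2 * a + 2 * a := by
          rw [integral_add (hi1.const_mul 2) (hi2.const_mul 2), integral_const_mul,
            integral_const_mul, h1, h2]
      _ = 4 * a := by ring
  rcases hk.eq_or_lt with hk0 | hkpos
  · -- k = 0
    rw [← hk0, hED]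
    nlinarith [hD0, ha0]
  -- co-area for ψ = f²
  have hhalf' : π.real {x | 0 < f x ^ 2} ≤ 1 / 2 := by
    have hset : {x | 0 < f x ^ 2} = {x | 0 < f x} := by
      ext x
      simp only [mem_setOf_eq]
      constructor
      · intro h
        rcases (hf0 x).eq_or_lt with h0 | h0
        · exfalso; rw [← h0] at h; norm_num at h
        · exact h0
      · intro h; positivity
    rw [hset]; exact hhalf
  have hco := coarea_integral_le hfst hsnd hk hcond hsqm (fun x => sq_nonneg _) hsqb hhalf'
  -- pointwise AM–GM: |f²x − f²y| = |fx − fy|(fx+fy) ≤ (2/k)(fx−fy)² + (k/8)(fx+fy)²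
  have hpt : ∀ p : X × X, |f p.1 ^ 2 - f p.2 ^ 2| ≤
      2 / k * (f p.1 - f p.2) ^ 2 + k / 8 * (f p.1 + f p.2) ^ 2 := by
    intro p
    have hfac : f p.1 ^ 2 - f p.2 ^ 2 = (f p.1 - f p.2) * (f p.1 + f p.2) := by ring
    rw [hfac, abs_mul, abs_of_nonneg (add_nonneg (hf0 _) (hf0 _))]
    exact abs_mul_le_amgm hkpos _ _
  have habs_i : Integrable (fun p : X × X => |f p.1 ^ 2 - f p.2 ^ 2|) ρ := by
    refine integrable_of_abs_le
      (continuous_abs.measurable.comp ((hsqm.comp measurable_fst).sub (hsqm.comp measurable_snd)))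
      (C := 2 * C ^ 2) fun p => ?_
    rw [abs_abs]
    calc |f p.1 ^ 2 - f p.2 ^ 2| ≤ |f p.1 ^ 2| + |f p.2 ^ 2| := abs_sub _ _
      _ ≤ 2 * C ^ 2 := by linarith [hsqb p.1, hsqb p.2]
  have hint : ∫ p, |f p.1 ^ 2 - f p.2 ^ 2| ∂ρ ≤ 2 / k * D + k / 8 * S := by
    calc ∫ p, |f p.1 ^ 2 - f p.2 ^ 2| ∂ρ
        ≤ ∫ p, (2 / k * (f p.1 - f p.2) ^ 2 + k / 8 * (f p.1 + f p.2) ^ 2) ∂ρ :=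
          integral_mono habs_i ((hDi.const_mul _).add (hSi.const_mul _)) hpt
      _ = 2 / k * D + k / 8 * S := by
          rw [integral_add (hDi.const_mul _) (hSi.const_mul _), integral_const_mul,
            integral_const_mul]
  -- combine: k a ≤ (2/k) D + (k/8) S ≤ (2/k) D + (k/2) a
  have hmain : k * a ≤ 2 / k * D + k / 2 * a := by
    have : k / 8 * S ≤ k / 2 * a := by nlinarith [hS4, hkpos.le]
    linarith [hco, hint]
  -- hence k² a ≤ 4 D, i.e. (k²/8) a ≤ D/2
  have hk' : k ≠ 0 := hkpos.ne'
  have h4 : k ^ 2 * a ≤ 4 * D := by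
    have h1 : k * (k * a) ≤ k * (2 / k * D + k / 2 * a) :=
      mul_le_mul_of_nonneg_left hmain hkpos.le
    have h2 : k * (2 / k * D + k / 2 * a) = 2 * D + k ^ 2 / 2 * a := by
      field_simp
    rw [h2] at h1
    nlinarith [h1]
  rw [hED]
  linarith

end Squares

/-! ### Step 3: a median, and the variance bound (Lawler–Sokal Thm 2.1 / LPW Thm 13.10, lower bound) -/

section Median

variable {π : Measure X} [IsProbabilityMeasure π]

/-- **A median exists** for every bounded real function under a probability measure: there is `c`
with `π{f > c} ≤ ½` and `π{f < c} ≤ ½` (take `c = inf {t : π{f > t} ≤ ½}`; continuity of the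
measure along monotone sequences gives both inequalities) — the device of Lawler–Sokal's proof
("Let `c` be a real constant (to be determined later) and define `g = f + c`", the constant being
chosen so that both signed parts live on sets of mass `≤ ½`), cf. the finite-space
`Literature.Probability.MarkovChains.exists_median`.
[cite: LawlerSokal1988, §2, proof of Thm 2.1 (choice of the constant `c`)] -/
theorem exists_median_real {f : X → ℝ} (hfm : Measurable f) {C : ℝ} (hC : ∀ x, |f x| ≤ C) :
    ∃ c : ℝ, π.real {x | c < f x} ≤ 1 / 2 ∧ π.real {x | f x < c} ≤ 1 / 2 := by
  set T : Set ℝ := {t | π.real {x | t < f x} ≤ 1 / 2} with hT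
  have hCT : C ∈ T := by
    have hempty : {x | C < f x} = ∅ := by
      ext x
      simp only [mem_setOf_eq, mem_empty_iff_false, iff_false, not_lt]
      exact (le_abs_self _).trans (hC x)
    simp only [hT, mem_setOf_eq, hempty, measureReal_empty]
    norm_num
  have hbdd : BddBelow T := by
    refine ⟨-C - 1, fun t ht => ?_⟩
    by_contra hlt
    have hlt : t < -C - 1 := not_le.mp hlt
    have huniv : {x | t < f x} = univ := by
      ext x
      simp only [mem_setOf_eq, mem_univ, iff_true]
      have := neg_abs_le (f x)
      linarith [hC x]
    have h1 : π.real {x | t < f x} = 1 := by rw [huniv, probReal_univ]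
    have ht' : π.real {x | t < f x} ≤ 1 / 2 := ht
    rw [h1] at ht'
    norm_num at ht'
  set c := sInf T with hc
  -- monotonicity of `t ↦ π{f > t}`
  have hmono : ∀ s t : ℝ, s ≤ t → π.real {x | t < f x} ≤ π.real {x | s < f x} :=
    fun s t hst => measureReal_mono fun x hx => lt_of_le_of_lt hst hx
  refine ⟨c, ?_, ?_⟩
  · -- `{f > c} = ⋃ₙ {f > c + 1/(n+1)}`, an increasing union of sets of mass ≤ 1/2
    have hmem : ∀ n : ℕ, π.real {x | c + 1 / ((n : ℝ) + 1) < f x} ≤ 1 / 2 := by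
      intro n
      have hpos : (0 : ℝ) < 1 / ((n : ℝ) + 1) := by positivity
      obtain ⟨t, htT, htlt⟩ :=
        (csInf_lt_iff hbdd ⟨C, hCT⟩).1 (show sInf T < c + 1 / ((n : ℝ) + 1) by linarith)
      exact (hmono t _ htlt.le).trans htT
    have hU : {x | c < f x} = ⋃ n : ℕ, {x | c + 1 / ((n : ℝ) + 1) < f x} := by
      ext x
      simp only [mem_setOf_eq, mem_iUnion]
      constructor
      · intro h
        obtain ⟨n, hn⟩ := exists_nat_one_div_lt (sub_pos.2 h)
        exact ⟨n, by linarith⟩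
      · rintro ⟨n, hn⟩
        have : (0 : ℝ) < 1 / ((n : ℝ) + 1) := by positivity
        linarith
    have hdir : Monotone fun n : ℕ => {x | c + 1 / ((n : ℝ) + 1) < f x} := by
      intro m n hmn x hx
      simp only [mem_setOf_eq] at hx ⊢
      have : 1 / ((n : ℝ) + 1) ≤ 1 / ((m : ℝ) + 1) :=
        one_div_le_one_div_of_le (by positivity) (by exact_mod_cast Nat.succ_le_succ hmn)
      linarith
    rw [hU, measureReal_def, hdir.measure_iUnion, ENNReal.toReal_iSup (fun n => measure_ne_top π _)]
    exact ciSup_le fun n => hmem n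
  · -- `{f < c} = ⋃ₙ {f ≤ c − 1/(n+1)}` and `π{f ≤ t} ≤ 1/2` for `t < c` (as `t ∉ T`)
    have hmem : ∀ n : ℕ, π.real {x | f x ≤ c - 1 / ((n : ℝ) + 1)} ≤ 1 / 2 := by
      intro n
      have hpos : (0 : ℝ) < 1 / ((n : ℝ) + 1) := by positivity
      have htT : c - 1 / ((n : ℝ) + 1) ∉ T := fun htT => by
        have := csInf_le hbdd htT
        linarith
      have hgt : 1 / 2 < π.real {x | c - 1 / ((n : ℝ) + 1) < f x} := by
        simp only [hT, mem_setOf_eq, not_le] at htT; exact htT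
      have hcomp : π.real {x | f x ≤ c - 1 / ((n : ℝ) + 1)} =
          1 - π.real {x | c - 1 / ((n : ℝ) + 1) < f x} := by
        have hset : {x | f x ≤ c - 1 / ((n : ℝ) + 1)} = {x | c - 1 / ((n : ℝ) + 1) < f x}ᶜ := by
          ext x; simp [not_lt]
        rw [hset, probReal_compl_eq_one_sub (measurableSet_lt measurable_const hfm)]
      rw [hcomp]; linarith
    have hU : {x | f x < c} = ⋃ n : ℕ, {x | f x ≤ c - 1 / ((n : ℝ) + 1)} := by
      ext x
      simp only [mem_setOf_eq, mem_iUnion]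
      constructor
      · intro h
        obtain ⟨n, hn⟩ := exists_nat_one_div_lt (sub_pos.2 h)
        exact ⟨n, by linarith⟩
      · rintro ⟨n, hn⟩
        have : (0 : ℝ) < 1 / ((n : ℝ) + 1) := by positivity
        linarith
    have hdir : Monotone fun n : ℕ => {x | f x ≤ c - 1 / ((n : ℝ) + 1)} := by
      intro m n hmn x hx
      simp only [mem_setOf_eq] at hx ⊢
      have : 1 / ((n : ℝ) + 1) ≤ 1 / ((m : ℝ) + 1) :=
        one_div_le_one_div_of_le (by positivity) (by exact_mod_cast Nat.succ_le_succ hmn)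
      linarith
    rw [hU, measureReal_def, hdir.measure_iUnion, ENNReal.toReal_iSup (fun n => measure_ne_top π _)]
    exact ciSup_le fun n => hmem n

/-- Positive and negative parts do not increase squared increments:
`(a⁺ − b⁺)² + (a⁻ − b⁻)² ≤ (a − b)²` (with `u⁺ = max u 0`, `u⁻ = max (−u) 0`). [folklore] -/
private theorem sq_posPart_sub_add_sq_negPart_sub_le (a b : ℝ) :
    (max a 0 - max b 0) ^ 2 + (max (-a) 0 - max (-b) 0) ^ 2 ≤ (a - b) ^ 2 := by
  rcases le_total 0 a with ha | ha <;> rcases le_total 0 b with hb | hb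
  · rw [max_eq_left ha, max_eq_left hb, max_eq_right (by linarith), max_eq_right (by linarith)]
    nlinarith
  · rw [max_eq_left ha, max_eq_right hb, max_eq_right (by linarith), max_eq_left (by linarith)]
    nlinarith
  · rw [max_eq_right ha, max_eq_left hb, max_eq_left (by linarith), max_eq_right (by linarith)]
    nlinarith
  · rw [max_eq_right ha, max_eq_right hb, max_eq_left (by linarith), max_eq_left (by linarith)]
    nlinarith

/-- `(u⁺)² + (u⁻)² = u²`. [folklore] -/
private theorem sq_posPart_add_sq_negPart (u : ℝ) : (max u 0) ^ 2 + (max (-u) 0) ^ 2 = u ^ 2 := by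
  rcases le_total 0 u with h | h
  · rw [max_eq_left h, max_eq_right (by linarith)]; ring
  · rw [max_eq_right h, max_eq_left (by linarith)]; ring

variable {ρ : Measure (X × X)} [IsFiniteMeasure ρ]

/-- **Cheeger's inequality on a general state space — Lawler–Sokal 1988, Theorem 2.1 (lower
bound, discrete time `M = 1`, their constant `κ ≥ 1` replaced by `1`); Levin–Peres–Wilmer
Theorem 13.10 (lower bound) without finiteness.** Let `π` be a probability measure on a measurable
space `X` and `ρ` a finite measure on `X × X` with both marginals equal to `π`, and suppose the
conductance bound `k·π(A)·π(Aᶜ) ≤ ρ(A × Aᶜ)` for every measurable `A` (`k ≥ 0`). Then for every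
bounded measurable `f : X → ℝ`,
`(k²/8) · ∫ (f − ∫f dπ)² dπ ≤ 𝓔_ρ(f) = ½ ∫ (f x − f y)² dρ(x,y)`.
Printed: "`κ k²/8M ≤ λ₁(J) ≤ k`" (2.17), `λ₁(J) = inf spec (J ↾ 1^⊥)`, `J = I − P`, `M = 1` for
discrete time (p. 560); the variance form is the Rayleigh-quotient reading of `λ₁` and holds here
without reversibility. [cite: LawlerSokal1988, Thm 2.1 (2.17), lower bound] -/
theorem cheeger_variance_le_dirichletForm (hfst : ρ.fst = π) (hsnd : ρ.snd = π) {k : ℝ}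
    (hk : 0 ≤ k) (hcond : HasCouplingConductance π ρ k) {f : X → ℝ} (hfm : Measurable f)
    {C : ℝ} (hC : ∀ x, |f x| ≤ C) :
    k ^ 2 / 8 * ∫ x, (f x - ∫ y, f y ∂π) ^ 2 ∂π ≤ couplingDirichletForm ρ f := by
  obtain ⟨c, hc1, hc2⟩ := exists_median_real (π := π) hfm hC
  -- the two parts
  set fp : X → ℝ := fun x => max (f x - c) 0 with hfp
  set fm : X → ℝ := fun x => max (-(f x - c)) 0 with hfm'
  have hfpm : Measurable fp := (hfm.sub measurable_const).max measurable_const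
  have hfmm : Measurable fm := (hfm.sub measurable_const).neg.max measurable_const
  -- bounds: |f x − c| ≤ C + |c|
  have hb : ∀ x, |f x - c| ≤ C + |c| := fun x => by
    calc |f x - c| ≤ |f x| + |c| := abs_sub _ _
      _ ≤ C + |c| := by linarith [hC x]
  have hfpb : ∀ x, |fp x| ≤ C + |c| := fun x => by
    simp only [hfp]
    rw [abs_of_nonneg (le_max_right _ _)]
    exact max_le ((le_abs_self _).trans (hb x)) ((abs_nonneg _).trans (hb x))
  have hfmb : ∀ x, |fm x| ≤ C + |c| := fun x => by
    simp only [hfm']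
    rw [abs_of_nonneg (le_max_right _ _)]
    exact max_le ((neg_le_abs _).trans (hb x)) ((abs_nonneg _).trans (hb x))
  have hsupp_p : π.real {x | 0 < fp x} ≤ 1 / 2 := by
    have hset : {x | 0 < fp x} = {x | c < f x} := by
      ext x
      simp only [hfp, mem_setOf_eq, lt_max_iff, lt_self_iff_false, or_false, sub_pos]
    rw [hset]; exact hc1
  have hsupp_m : π.real {x | 0 < fm x} ≤ 1 / 2 := by
    have hset : {x | 0 < fm x} = {x | f x < c} := by
      ext x
      simp only [hfm', mem_setOf_eq, lt_max_iff, lt_self_iff_false, or_false, neg_pos, sub_neg]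
    rw [hset]; exact hc2
  have hP := cheeger_sq_integral_le_dirichletForm hfst hsnd hk hcond hfpm
    (fun x => le_max_right _ _) hfpb hsupp_p
  have hM := cheeger_sq_integral_le_dirichletForm hfst hsnd hk hcond hfmm
    (fun x => le_max_right _ _) hfmb hsupp_m
  -- integrability of squared increments on `ρ`
  have hint_g : ∀ {g : X → ℝ}, Measurable g → ∀ {B : ℝ}, (∀ x, |g x| ≤ B) →
      Integrable (fun p : X × X => (g p.1 - g p.2) ^ 2) ρ := by
    intro g hg B hgb
    refine integrable_of_abs_le (((hg.comp measurable_fst).sub (hg.comp measurable_snd)).pow_const 2)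
      (C := (2 * B) ^ 2) fun p => ?_
    rw [abs_pow]
    refine pow_le_pow_left₀ (abs_nonneg _) ?_ 2
    calc |g p.1 - g p.2| ≤ |g p.1| + |g p.2| := abs_sub _ _
      _ ≤ 2 * B := by linarith [hgb p.1, hgb p.2]
  -- 𝓔(f₊) + 𝓔(f₋) ≤ 𝓔(f)
  have hE : couplingDirichletForm ρ fp + couplingDirichletForm ρ fm ≤ couplingDirichletForm ρ f := by
    simp only [couplingDirichletForm]
    rw [← mul_add, ← integral_add (hint_g hfpm hfpb) (hint_g hfmm hfmb)]
    refine mul_le_mul_of_nonneg_left (integral_mono ((hint_g hfpm hfpb).add (hint_g hfmm hfmb))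
      (hint_g hfm hC) fun p => ?_) (by norm_num)
    have key := sq_posPart_sub_add_sq_negPart_sub_le (f p.1 - c) (f p.2 - c)
    have hrw : (f p.1 - c) - (f p.2 - c) = f p.1 - f p.2 := by ring
    rw [hrw] at key
    simpa only [hfp, hfm'] using key
  -- Var ≤ ∫ (f − c)² = ∫ f₊² + ∫ f₋²
  set m : ℝ := ∫ y, f y ∂π with hmdef
  have hfi : Integrable f π := integrable_of_abs_le hfm hC
  have hlin : Integrable (fun x => f x - m) π := hfi.sub (integrable_const m)
  have hsq_m : Integrable (fun x => (f x - m) ^ 2) π := by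
    refine integrable_of_abs_le ((hfm.sub measurable_const).pow_const 2) (C := (C + |m|) ^ 2)
      fun x => ?_
    rw [abs_pow]
    refine pow_le_pow_left₀ (abs_nonneg _) ?_ 2
    calc |f x - m| ≤ |f x| + |m| := abs_sub _ _
      _ ≤ C + |m| := by linarith [hC x]
  have hvar : ∫ x, (f x - m) ^ 2 ∂π ≤ ∫ x, (f x - c) ^ 2 ∂π := by
    -- ∫(f−c)² = ∫(f−m)² + (m−c)² since ∫(f − m) = 0
    have hzero : ∫ x, (f x - m) ∂π = 0 := by
      rw [integral_sub hfi (integrable_const m), integral_const, smul_eq_mul, probReal_univ,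
        one_mul, hmdef, sub_self]
    have hdecomp : ∫ x, (f x - c) ^ 2 ∂π =
        ∫ x, (f x - m) ^ 2 ∂π + (2 * (m - c) * ∫ x, (f x - m) ∂π + (m - c) ^ 2) := by
      have hpt : ∀ x, (f x - c) ^ 2 = (f x - m) ^ 2 + (2 * (m - c) * (f x - m) + (m - c) ^ 2) :=
        fun x => by ring
      have hI1 : Integrable (fun x => 2 * (m - c) * (f x - m)) π := hlin.const_mul _
      have hI2 : Integrable (fun x => 2 * (m - c) * (f x - m) + (m - c) ^ 2) π :=
        hI1.add (integrable_const _)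
      simp_rw [hpt]
      rw [integral_add hsq_m hI2, integral_add hI1 (integrable_const _), integral_const_mul,
        integral_const, smul_eq_mul, probReal_univ, one_mul]
    rw [hdecomp, hzero]
    nlinarith [sq_nonneg (m - c)]
  have hsplit : ∫ x, (f x - c) ^ 2 ∂π = ∫ x, fp x ^ 2 ∂π + ∫ x, fm x ^ 2 ∂π := by
    have hi1 : Integrable (fun x => fp x ^ 2) π := by
      refine integrable_of_abs_le (hfpm.pow_const 2) (C := (C + |c|) ^ 2) fun x => ?_
      rw [abs_pow]; exact pow_le_pow_left₀ (abs_nonneg _) (hfpb x) 2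
    have hi2 : Integrable (fun x => fm x ^ 2) π := by
      refine integrable_of_abs_le (hfmm.pow_const 2) (C := (C + |c|) ^ 2) fun x => ?_
      rw [abs_pow]; exact pow_le_pow_left₀ (abs_nonneg _) (hfmb x) 2
    rw [← integral_add hi1 hi2]
    refine integral_congr_ae (Filter.Eventually.of_forall fun x => ?_)
    simp only [hfp, hfm']
    exact (sq_posPart_add_sq_negPart (f x - c)).symm
  have hk2 : 0 ≤ k ^ 2 / 8 := by positivity
  calc k ^ 2 / 8 * ∫ x, (f x - m) ^ 2 ∂π ≤ k ^ 2 / 8 * ∫ x, (f x - c) ^ 2 ∂π :=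
        mul_le_mul_of_nonneg_left hvar hk2
    _ = k ^ 2 / 8 * ∫ x, fp x ^ 2 ∂π + k ^ 2 / 8 * ∫ x, fm x ^ 2 ∂π := by rw [hsplit, mul_add]
    _ ≤ couplingDirichletForm ρ fp + couplingDirichletForm ρ fm := add_le_add hP hM
    _ ≤ couplingDirichletForm ρ f := hE

end Median

/-! ### Step 4: Markov kernels with an invariant probability measure (`ρ = π ⊗ κ`) -/

section Kernel

open ProbabilityTheory

variable {π : Measure X} [IsProbabilityMeasure π] {κ : Kernel X X} [IsMarkovKernel κ]

/-- For `ρ = π ⊗ₘ κ` the setwise conductance hypothesis reads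
`k·π(A)·π(Aᶜ) ≤ ∫_A κ(x, Aᶜ) dπ(x)` (Lawler–Sokal (2.3): `ρ(A × Aᶜ) = ∫ π(dx) χ_A(x) P(x,Aᶜ)`).
[cite: LawlerSokal1988, §2 (2.3)] -/
theorem hasCouplingConductance_compProd_iff {k : ℝ} :
    HasCouplingConductance π (π ⊗ₘ κ) k ↔
      ∀ A : Set X, MeasurableSet A →
        k * π.real A * π.real Aᶜ ≤ ∫ x in A, (κ x).real Aᶜ ∂π := by
  have key : ∀ A : Set X, MeasurableSet A →
      (π ⊗ₘ κ).real (A ×ˢ Aᶜ) = ∫ x in A, (κ x).real Aᶜ ∂π := by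
    intro A hA
    simp only [measureReal_def]
    rw [Measure.compProd_apply_prod hA hA.compl,
      integral_toReal ((κ.measurable_coe hA.compl).aemeasurable)
        (Filter.Eventually.of_forall fun x => measure_lt_top _ _)]
  unfold HasCouplingConductance
  refine ⟨fun h A hA => ?_, fun h A hA => ?_⟩
  · rw [← key A hA]; exact h A hA
  · rw [key A hA]; exact h A hA

/-- For `ρ = π ⊗ₘ κ` the Dirichlet form is the iterated integral
`𝓔(f) = ½ ∫∫ (f x − f y)² κ(x,dy) π(dx)` (bounded measurable `f`). [cite: LawlerSokal1988, §2 (2.13)–(2.15)] -/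
theorem couplingDirichletForm_compProd_eq {f : X → ℝ} (hfm : Measurable f) {C : ℝ}
    (hC : ∀ x, |f x| ≤ C) :
    couplingDirichletForm (π ⊗ₘ κ) f = 1 / 2 * ∫ x, ∫ y, (f x - f y) ^ 2 ∂(κ x) ∂π := by
  simp only [couplingDirichletForm]
  congr 1
  have hm : Measurable fun p : X × X => (f p.1 - f p.2) ^ 2 :=
    ((hfm.comp measurable_fst).sub (hfm.comp measurable_snd)).pow_const 2
  have hi : Integrable (fun p : X × X => (f p.1 - f p.2) ^ 2) (π ⊗ₘ κ) := by
    refine integrable_of_abs_le hm (C := (2 * C) ^ 2) fun p => ?_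
    rw [abs_pow]
    refine pow_le_pow_left₀ (abs_nonneg _) ?_ 2
    calc |f p.1 - f p.2| ≤ |f p.1| + |f p.2| := abs_sub _ _
      _ ≤ 2 * C := by linarith [hC p.1, hC p.2]
  exact Measure.integral_compProd hi

/-- **Cheeger's inequality for a Markov kernel with an invariant probability measure**
(Lawler–Sokal Thm 2.1, lower bound, `M = 1`): if `π` is `κ`-invariant (`π.bind κ = π`) and
`k·π(A)·π(Aᶜ) ≤ ∫_A κ(x,Aᶜ) dπ(x)` for every measurable `A` (`k ≥ 0`), then for every bounded
measurable `f`, `(k²/8)·∫(f − ∫f dπ)² dπ ≤ ½∫∫(f x − f y)² κ(x,dy)π(dx)`.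
[cite: LawlerSokal1988, Thm 2.1 (2.17), lower bound] -/
theorem cheeger_variance_le_dirichletForm_kernel (hinv : κ.Invariant π) {k : ℝ} (hk : 0 ≤ k)
    (hcond : ∀ A : Set X, MeasurableSet A →
      k * π.real A * π.real Aᶜ ≤ ∫ x in A, (κ x).real Aᶜ ∂π)
    {f : X → ℝ} (hfm : Measurable f) {C : ℝ} (hC : ∀ x, |f x| ≤ C) :
    k ^ 2 / 8 * ∫ x, (f x - ∫ y, f y ∂π) ^ 2 ∂π ≤
      1 / 2 * ∫ x, ∫ y, (f x - f y) ^ 2 ∂(κ x) ∂π := by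
  have hfst : (π ⊗ₘ κ).fst = π := Measure.fst_compProd π κ
  have hsnd : (π ⊗ₘ κ).snd = π := by rw [Measure.snd_compProd]; exact hinv
  rw [← couplingDirichletForm_compProd_eq hfm hC]
  exact cheeger_variance_le_dirichletForm hfst hsnd hk (hasCouplingConductance_compProd_iff.2 hcond)
    hfm hC

/-- The Dirichlet form of an invariant Markov kernel against the quadratic form of its Markov
operator `(Pf)(x) = ∫ f dκ(x)`: `½∫∫(f x − f y)² κ(x,dy)π(dx) = ∫ f² dπ − ∫ f·(Pf) dπ` for `π`
invariant and `f` bounded measurable ("`(f, Jg) = ∫ρ(dx,dy) f(x)[g(x) − g(y)]`", (2.13) with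
`J = I − P`, `M = 1`). [cite: LawlerSokal1988, §2 (2.13)] -/
theorem dirichletForm_kernel_eq_sq_sub_inner (hinv : κ.Invariant π) {f : X → ℝ}
    (hfm : Measurable f) {C : ℝ} (hC : ∀ x, |f x| ≤ C) :
    1 / 2 * ∫ x, ∫ y, (f x - f y) ^ 2 ∂(κ x) ∂π =
      ∫ x, f x ^ 2 ∂π - ∫ x, f x * ∫ y, f y ∂(κ x) ∂π := by
  have hfst : (π ⊗ₘ κ).fst = π := Measure.fst_compProd π κ
  have hsnd : (π ⊗ₘ κ).snd = π := by rw [Measure.snd_compProd]; exact hinv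
  rw [← couplingDirichletForm_compProd_eq hfm hC]
  simp only [couplingDirichletForm]
  have hsqm : Measurable fun x => f x ^ 2 := hfm.pow_const 2
  have hsqb : ∀ x, |f x ^ 2| ≤ C ^ 2 := fun x => by
    rw [abs_pow]; exact pow_le_pow_left₀ (abs_nonneg _) (hC x) 2
  have hi1 : Integrable (fun p : X × X => f p.1 ^ 2) (π ⊗ₘ κ) :=
    integrable_of_abs_le (hsqm.comp measurable_fst) fun p => hsqb p.1
  have hi2 : Integrable (fun p : X × X => f p.2 ^ 2) (π ⊗ₘ κ) :=
    integrable_of_abs_le (hsqm.comp measurable_snd) fun p => hsqb p.2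
  have hprodm : Measurable fun p : X × X => f p.1 * f p.2 :=
    (hfm.comp measurable_fst).mul (hfm.comp measurable_snd)
  have hC0 : ∀ x, 0 ≤ C := fun x => (abs_nonneg _).trans (hC x)
  have hi3 : Integrable (fun p : X × X => f p.1 * f p.2) (π ⊗ₘ κ) := by
    refine integrable_of_abs_le hprodm (C := C * C) fun p => ?_
    rw [abs_mul]
    exact mul_le_mul (hC _) (hC _) (abs_nonneg _) (hC0 p.1)
  have h1 : ∫ p, f p.1 ^ 2 ∂(π ⊗ₘ κ) = ∫ x, f x ^ 2 ∂π := integral_comp_fst_eq hfst hsqm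
  have h2 : ∫ p, f p.2 ^ 2 ∂(π ⊗ₘ κ) = ∫ x, f x ^ 2 ∂π := integral_comp_snd_eq hsnd hsqm
  have h3 : ∫ p, f p.1 * f p.2 ∂(π ⊗ₘ κ) = ∫ x, f x * ∫ y, f y ∂(κ x) ∂π := by
    rw [Measure.integral_compProd hi3]
    refine integral_congr_ae (Filter.Eventually.of_forall fun x => ?_)
    exact integral_const_mul (f x) f
  have hpt : ∀ p : X × X, (f p.1 - f p.2) ^ 2 = (f p.1 ^ 2 + f p.2 ^ 2) - 2 * (f p.1 * f p.2) :=
    fun p => by ring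
  have hI12 : Integrable (fun p : X × X => f p.1 ^ 2 + f p.2 ^ 2) (π ⊗ₘ κ) := hi1.add hi2
  have hI3 : Integrable (fun p : X × X => 2 * (f p.1 * f p.2)) (π ⊗ₘ κ) := hi3.const_mul 2
  simp_rw [hpt]
  rw [integral_sub hI12 hI3, integral_add hi1 hi2, integral_const_mul, h1, h2, h3]
  ring

/-- **Rayleigh-quotient form on `1^⊥`** (the reading of Lawler–Sokal's `λ₁(I − P) ≥ k²/8` used for
transfer-matrix gaps): for `π` invariant, the setwise conductance bound with `k ≥ 0`, and a bounded
measurable `f` with `∫ f dπ = 0`, `∫ f·(Pf) dπ ≤ (1 − k²/8)·∫ f² dπ`. For a reversible nonnegative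
`P` this bounds `sup spec (P ↾ 1^⊥)` by `1 − k²/8`. [cite: LawlerSokal1988, Thm 2.1 (2.17), lower bound] -/
theorem cheeger_inner_kernel_le (hinv : κ.Invariant π) {k : ℝ} (hk : 0 ≤ k)
    (hcond : ∀ A : Set X, MeasurableSet A →
      k * π.real A * π.real Aᶜ ≤ ∫ x in A, (κ x).real Aᶜ ∂π)
    {f : X → ℝ} (hfm : Measurable f) {C : ℝ} (hC : ∀ x, |f x| ≤ C)
    (hmean : ∫ x, f x ∂π = 0) :
    ∫ x, f x * ∫ y, f y ∂(κ x) ∂π ≤ (1 - k ^ 2 / 8) * ∫ x, f x ^ 2 ∂π := by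
  have h := cheeger_variance_le_dirichletForm_kernel hinv hk hcond hfm hC
  rw [dirichletForm_kernel_eq_sq_sub_inner hinv hfm hC, hmean] at h
  simp only [sub_zero] at h
  linarith

end Kernel

/-! ### The trivial direction: the Rayleigh quotient of `1_A` is `k(A)` (Lawler–Sokal Thm 2.1, upper bound) -/

section Upper

variable {π : Measure X} [IsProbabilityMeasure π] {ρ : Measure (X × X)} [IsFiniteMeasure ρ]

omit [IsProbabilityMeasure π] in
/-- The Dirichlet form of an indicator is the boundary flow: `𝓔_ρ(1_A) = ρ(A × Aᶜ)`
(`= ½[ρ(A × Aᶜ) + ρ(Aᶜ × A)]` and the two flows agree by equal marginals) — the numerator of the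
Rayleigh quotient (2.18) of the trial function `χ_A − π(A)`. [cite: LawlerSokal1988, §2 (2.18), proof of the upper bound in Thm 2.1] -/
theorem couplingDirichletForm_indicator (hfst : ρ.fst = π) (hsnd : ρ.snd = π) {A : Set X}
    (hA : MeasurableSet A) :
    couplingDirichletForm ρ (A.indicator 1) = ρ.real (A ×ˢ Aᶜ) := by
  simp only [couplingDirichletForm]
  have hpt : ∀ p : X × X, (A.indicator (1 : X → ℝ) p.1 - A.indicator 1 p.2) ^ 2 =
      (A ×ˢ Aᶜ).indicator 1 p + (Aᶜ ×ˢ A).indicator 1 p := by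
    intro p
    by_cases h1 : p.1 ∈ A <;> by_cases h2 : p.2 ∈ A <;>
      simp [Set.indicator, h1, h2, Set.mem_prod]
  simp_rw [hpt]
  have hi1 : Integrable ((A ×ˢ Aᶜ).indicator (1 : X × X → ℝ)) ρ :=
    (integrable_const 1).indicator (hA.prod hA.compl)
  have hi2 : Integrable ((Aᶜ ×ˢ A).indicator (1 : X × X → ℝ)) ρ :=
    (integrable_const 1).indicator (hA.compl.prod hA)
  rw [integral_add hi1 hi2, integral_indicator_one (hA.prod hA.compl),
    integral_indicator_one (hA.compl.prod hA), measureReal_def (s := Aᶜ ×ˢ A),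
    measure_compl_prod_eq_prod_compl hfst hsnd hA, ← measureReal_def]
  ring

omit [IsFiniteMeasure ρ] in
/-- The variance of an indicator under a probability measure: `∫ (1_A − π(A))² dπ = π(A)·π(Aᶜ)` —
the denominator of the Rayleigh quotient (2.18). [cite: LawlerSokal1988, §2 (2.18), proof of the upper bound in Thm 2.1] -/
theorem integral_sq_indicator_sub_mean {A : Set X} (hA : MeasurableSet A) :
    ∫ x, (A.indicator (1 : X → ℝ) x - ∫ y, A.indicator (1 : X → ℝ) y ∂π) ^ 2 ∂π =
      π.real A * π.real Aᶜ := by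
  rw [integral_indicator_one hA]
  set q : ℝ := π.real A with hq
  have hpt : ∀ x, (A.indicator (1 : X → ℝ) x - q) ^ 2 =
      (1 - 2 * q) * A.indicator (1 : X → ℝ) x + q ^ 2 := by
    intro x
    by_cases hx : x ∈ A
    · simp [Set.indicator, hx]; ring
    · simp [Set.indicator, hx]
  simp_rw [hpt]
  have hi : Integrable (fun x => (1 - 2 * q) * A.indicator (1 : X → ℝ) x) π :=
    ((integrable_const 1).indicator hA).const_mul _
  rw [integral_add hi (integrable_const _), integral_const_mul, integral_indicator_one hA,
    integral_const, smul_eq_mul, probReal_univ, one_mul, probReal_compl_eq_one_sub hA, ← hq]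
  ring

/-- **Lawler–Sokal Thm 2.1, the (trivial) upper bound `λ₁ ≤ k`, in Rayleigh-quotient form**: for
every measurable `A` the trial function `1_A` (equivalently `χ_A − π(A)`, (2.4)) has
`𝓔_ρ(1_A) = k(A) · Var_π(1_A)` with `k(A) = ρ(A × Aᶜ)/(π(A)π(Aᶜ))` whenever `π(A)π(Aᶜ) ≠ 0`; hence
no constant larger than `k(A)` can replace `k²/8` in `cheeger_variance_le_dirichletForm`.
"A simple computation yields the Rayleigh quotient (2.18)". [cite: LawlerSokal1988, Thm 2.1 (2.17) upper bound, (2.18)] -/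
theorem couplingDirichletForm_indicator_eq_conductance_mul (hfst : ρ.fst = π) (hsnd : ρ.snd = π)
    {A : Set X} (hA : MeasurableSet A) (hA0 : π.real A * π.real Aᶜ ≠ 0) :
    couplingDirichletForm ρ (A.indicator 1) =
      ρ.real (A ×ˢ Aᶜ) / (π.real A * π.real Aᶜ) *
        ∫ x, (A.indicator (1 : X → ℝ) x - ∫ y, A.indicator (1 : X → ℝ) y ∂π) ^ 2 ∂π := by
  rw [couplingDirichletForm_indicator hfst hsnd hA, integral_sq_indicator_sub_mean hA,
    div_mul_cancel₀ _ hA0]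

/-- Consequently any constant `γ` with `γ · Var_π(f) ≤ 𝓔_ρ(f)` for all bounded measurable `f`
satisfies `γ ≤ k(A)` for every measurable `A` with `π(A)π(Aᶜ) ≠ 0` — the upper bound `λ₁ ≤ k` of
(2.17) in variational form. [cite: LawlerSokal1988, Thm 2.1 (2.17), upper bound] -/
theorem poincareConstant_le_conductance (hfst : ρ.fst = π) (hsnd : ρ.snd = π) {γ : ℝ}
    (hγ : ∀ f : X → ℝ, Measurable f → (∃ C : ℝ, ∀ x, |f x| ≤ C) →
      γ * ∫ x, (f x - ∫ y, f y ∂π) ^ 2 ∂π ≤ couplingDirichletForm ρ f)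
    {A : Set X} (hA : MeasurableSet A) (hA0 : π.real A * π.real Aᶜ ≠ 0) :
    γ ≤ ρ.real (A ×ˢ Aᶜ) / (π.real A * π.real Aᶜ) := by
  have hmeas : Measurable (A.indicator (1 : X → ℝ)) := measurable_const.indicator hA
  have hbdd : ∃ C : ℝ, ∀ x, |A.indicator (1 : X → ℝ) x| ≤ C := by
    refine ⟨1, fun x => ?_⟩
    by_cases hx : x ∈ A <;> simp [Set.indicator, hx]
  have h := hγ _ hmeas hbdd
  rw [couplingDirichletForm_indicator_eq_conductance_mul hfst hsnd hA hA0,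
    integral_sq_indicator_sub_mean hA] at h
  have hpos : 0 < π.real A * π.real Aᶜ :=
    lt_of_le_of_ne (mul_nonneg measureReal_nonneg measureReal_nonneg) (Ne.symm hA0)
  exact le_of_mul_le_mul_right h hpos

end Upper

end Literature.Probability.MarkovChains

end
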